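import Mathlib
import Literature.Probability.LatticeModels.CriticalTwoPointDCPLowerHolds
import Literature.Probability.LatticeModels.IsingExponentsProofs
import Literature.Probability.LatticeModels.CriticalTwoPointBounds
import Literature.Probability.LatticeModels.CriticalTwoPointLawDimension
import Literature.Probability.LatticeModels.CorrelationDecayProofs
import Literature.Probability.LatticeModels.HighDimPointwiseTriviality
import Literature.Probability.LatticeModels.SharpnessProofs
import HarnessLib

/-!
# Stub `stub_exponentWindow` of line `diffusive-branch-is-nonsaturation` (crux
# `PrecisionLaplacian.DirectCorrelationStableTail`, stmt-CriticalPhenomena-4799): the exponent window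

**Statement** (registered text).  Write `G = criticalTwoPoint 3` for the critical two-point function
`⟨σ₀σ_x⟩⁺_{β_c}` of the nearest-neighbour Ising model on `ℤ³`, `|x|₂ = √(Σᵢ xᵢ²)` for the Euclidean
and `‖x‖` for the sup norm of `x ∈ ℤ³`.  Assume NonSaturation (`∀ ε > 0`, frequently in `n`,
`n · G(n e₀) < ε`) and the isotropic pure power law (`G(x)|x|₂^{2Δ} → c > 0` along the cofinite
filter).  Then there are `α ∈ (1, 2)`, `c > 0`, `c₁ > 0`, `C₁` and `R₀ : ℕ` with
`G(x)|x|₂^{3−α} → c` cofinitely, `G(x) ≤ C₁‖x‖^{α−3}` for all `x ≠ 0` and `c₁‖x‖^{α−3} ≤ G(x)`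
whenever `‖x‖ ≥ R₀`.

**Proof.**  Obtain `Δ, c`.  The tree theorem `twoPointLaw_exponent_mem_Icc` (a consequence of the
proved bounds `c'‖x‖⁻² ≤ G ≤ C'‖x‖⁻¹`, `criticalTwoPoint_bounds_holds`) gives `1/2 ≤ Δ ≤ 1`.  If
`Δ = 1/2`, then along the axis `x_n = n e₀` (an injective sequence, hence cofinitely divergent)
`n G(n e₀) = G(x_n)|x_n|₂ → c > 0`, so eventually `n G(n e₀) > c/2`, contradicting NonSaturation at
`ε = c/2`; hence `Δ > 1/2`.  Cofinitely `c/2 < G|x|₂^{2Δ} < 2c`; outside a finite set, i.e. for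
`‖x‖ ≥ R₀`, this and `‖x‖ ≤ |x|₂ ≤ √3‖x‖` give `(c/2)3^{−Δ}‖x‖^{−2Δ} ≤ G(x) ≤ 2c‖x‖^{−2Δ}`, and the
finitely many `0 < ‖x‖ < R₀` are absorbed using `G ≤ 1` (upper) and `G ≥ c'‖x‖⁻² ≥ c'R₀⁻²` (lower).
So `G` obeys two-sided power bounds with exponent `2Δ`, i.e. `HasIsingEtaBounds 3 (2Δ − 1)`, whence
the logarithmic exponent `HasIsingExponentEta 3 (2Δ − 1)` (`HasIsingEtaBounds.hasIsingExponentEta'`)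
and Duminil-Copin–Panis 2025, Theorem 1.5 (`dcp_isingEta_le_half_holds`, proved in the tree) gives
`2Δ − 1 ≤ 1/2`.  Put `α := 3 − 2Δ ∈ [3/2, 2)`.  Pure theorem file, no definitions, no `sorry`.
References: Duminil-Copin–Panis (2025), Thm 1.5 (through the tree theorem); otherwise folklore.
-/

noncomputable section

namespace Summit.CriticalPhenomena.Ising3DConformalLimit.Cruxes.DirectCorrelationStableTail.DiffusiveBranchIsNonsaturation

open MeasureTheory Filter Topology
open scoped BigOperators
open Literature.Probability.LatticeModels

/-! ### Norm comparisons on `ℤ³` -/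

/-- The Euclidean norm `|x|₂ = √(Σᵢ xᵢ²)` dominates the sup norm of `ℤ³`. [folklore] -/
theorem expWin_norm_le_euclid (x : Site 3) : ‖x‖ ≤ Real.sqrt (∑ i, ((x i : ℝ)) ^ 2) := by
  -- adapted from `KernelTransfer.norm_le_sqrt_sum_sq`
  refine (pi_norm_le_iff_of_nonneg (Real.sqrt_nonneg _)).2 fun i => ?_
  rw [Int.norm_eq_abs]
  refine Real.abs_le_sqrt ?_
  exact Finset.single_le_sum (f := fun j => ((x j : ℝ)) ^ 2) (fun j _ => sq_nonneg _)
    (Finset.mem_univ i)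

/-- The Euclidean norm of `x ∈ ℤ³` is at most `√3` times its sup norm. [folklore] -/
theorem expWin_euclid_le_sqrt_three_mul_norm (x : Site 3) :
    Real.sqrt (∑ i, ((x i : ℝ)) ^ 2) ≤ Real.sqrt 3 * ‖x‖ := by
  have hi : ∀ i, ((x i : ℝ)) ^ 2 ≤ ‖x‖ ^ 2 := by
    intro i
    have h1 : |((x i : ℝ))| ≤ ‖x‖ := by
      have h := norm_le_pi_norm x i
      rwa [Int.norm_eq_abs] at h
    have h2 : |((x i : ℝ))| ^ 2 ≤ ‖x‖ ^ 2 := pow_le_pow_left₀ (abs_nonneg _) h1 2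
    rwa [sq_abs] at h2
  have hsum : (∑ i, ((x i : ℝ)) ^ 2) ≤ 3 * ‖x‖ ^ 2 := by
    calc (∑ i, ((x i : ℝ)) ^ 2) ≤ ∑ _i : Fin 3, ‖x‖ ^ 2 := Finset.sum_le_sum fun i _ => hi i
      _ = 3 * ‖x‖ ^ 2 := by simp
  calc Real.sqrt (∑ i, ((x i : ℝ)) ^ 2) ≤ Real.sqrt (3 * ‖x‖ ^ 2) := Real.sqrt_le_sqrt hsum
    _ = Real.sqrt 3 * ‖x‖ := by
        rw [Real.sqrt_mul (by norm_num : (0 : ℝ) ≤ 3), Real.sqrt_sq (norm_nonneg _)]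

/-- A cofinitely-eventual property of lattice points holds outside a large sup-norm ball (of
radius `≥ 1`). [folklore] -/
theorem expWin_radius_of_eventually {P : Site 3 → Prop} (h : ∀ᶠ x in cofinite, P x) :
    ∃ N : ℕ, 1 ≤ N ∧ ∀ x : Site 3, (N : ℝ) ≤ ‖x‖ → P x := by
  -- adapted from `coneTail_eventually`
  rw [Filter.eventually_cofinite] at h
  refine ⟨h.toFinset.sup Site.supNorm + 1, Nat.le_add_left 1 _, fun x hx => ?_⟩
  by_contra hP
  have hmem : x ∈ h.toFinset := h.mem_toFinset.2 hP
  have h1 := Finset.le_sup (f := Site.supNorm) hmem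
  rw [Site.norm_eq_supNorm] at hx
  have h2 : h.toFinset.sup Site.supNorm + 1 ≤ Site.supNorm x := by exact_mod_cast hx
  omega

/-! ### Scale bounds from a pure power law -/

/-- **Two-sided sup-norm scale bounds from an isotropic pure power law (Ising-free).**  If
`G ≤ 1` on `ℤ³` and `G(x)|x|₂^κ → c > 0` cofinitely (`κ ≥ 0`), then `G(x) ≤ C₁‖x‖^{−κ}` for all
`x ≠ 0` and `c₁‖x‖^{−κ} ≤ G(x)` for `‖x‖ ≥ R₀`, with `c₁ = (c/2)(√3)^{−κ} > 0`,
`C₁ = max(2c, R₀^κ)`, `R₀ ≥ 1`. [folklore] -/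
theorem expWin_scaleBounds_of_tendsto {G : Site 3 → ℝ} {κ c : ℝ} (hκ : 0 ≤ κ) (hc : 0 < c)
    (hG1 : ∀ x, G x ≤ 1)
    (hT : Tendsto (fun x : Site 3 => G x * Real.sqrt (∑ i, ((x i : ℝ)) ^ 2) ^ κ) cofinite (𝓝 c)) :
    ∃ (c₁ C₁ : ℝ) (R₀ : ℕ), 0 < c₁ ∧ 1 ≤ R₀ ∧
      (∀ x : Site 3, x ≠ 0 → G x ≤ C₁ * ‖x‖ ^ (-κ)) ∧
      (∀ x : Site 3, (R₀ : ℝ) ≤ ‖x‖ → c₁ * ‖x‖ ^ (-κ) ≤ G x) := by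
  have hev : ∀ᶠ x : Site 3 in cofinite,
      c / 2 < G x * Real.sqrt (∑ i, ((x i : ℝ)) ^ 2) ^ κ ∧
        G x * Real.sqrt (∑ i, ((x i : ℝ)) ^ 2) ^ κ < 2 * c :=
    (hT.eventually (lt_mem_nhds (by linarith))).and (hT.eventually (gt_mem_nhds (by linarith)))
  obtain ⟨R₀, hR₀1, hR₀⟩ := expWin_radius_of_eventually hev
  have h3 : 0 < Real.sqrt 3 := Real.sqrt_pos.2 (by norm_num)
  refine ⟨c / 2 * Real.sqrt 3 ^ (-κ), max (2 * c) ((R₀ : ℝ) ^ κ), R₀,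
    mul_pos (half_pos hc) (Real.rpow_pos_of_pos h3 _), hR₀1, ?_, ?_⟩
  · intro x hx
    have hx0 : 0 < ‖x‖ := norm_pos_iff.2 hx
    have hE0 : 0 < Real.sqrt (∑ i, ((x i : ℝ)) ^ 2) := lt_of_lt_of_le hx0 (expWin_norm_le_euclid x)
    rcases le_or_gt (R₀ : ℝ) ‖x‖ with hR | hR
    · obtain ⟨-, hup⟩ := hR₀ x hR
      have h1 : G x ≤ 2 * c * Real.sqrt (∑ i, ((x i : ℝ)) ^ 2) ^ (-κ) := by
        rw [Real.rpow_neg hE0.le, ← div_eq_mul_inv, le_div_iff₀ (Real.rpow_pos_of_pos hE0 _)]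
        exact hup.le
      have h2 : Real.sqrt (∑ i, ((x i : ℝ)) ^ 2) ^ (-κ) ≤ ‖x‖ ^ (-κ) :=
        Real.rpow_le_rpow_of_nonpos hx0 (expWin_norm_le_euclid x) (by linarith)
      calc G x ≤ 2 * c * Real.sqrt (∑ i, ((x i : ℝ)) ^ 2) ^ (-κ) := h1
        _ ≤ 2 * c * ‖x‖ ^ (-κ) := mul_le_mul_of_nonneg_left h2 (by linarith)
        _ ≤ max (2 * c) ((R₀ : ℝ) ^ κ) * ‖x‖ ^ (-κ) :=
            mul_le_mul_of_nonneg_right (le_max_left _ _) (Real.rpow_nonneg hx0.le _)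
    · have h1 : (1 : ℝ) ≤ (R₀ : ℝ) ^ κ * ‖x‖ ^ (-κ) := by
        rw [Real.rpow_neg hx0.le, ← div_eq_mul_inv, one_le_div (Real.rpow_pos_of_pos hx0 _)]
        exact Real.rpow_le_rpow hx0.le hR.le hκ
      calc G x ≤ 1 := hG1 x
        _ ≤ (R₀ : ℝ) ^ κ * ‖x‖ ^ (-κ) := h1
        _ ≤ max (2 * c) ((R₀ : ℝ) ^ κ) * ‖x‖ ^ (-κ) :=
            mul_le_mul_of_nonneg_right (le_max_right _ _) (Real.rpow_nonneg hx0.le _)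
  · intro x hR
    have hx0 : 0 < ‖x‖ := lt_of_lt_of_le (Nat.cast_pos.2 hR₀1) hR
    have hE0 : 0 < Real.sqrt (∑ i, ((x i : ℝ)) ^ 2) := lt_of_lt_of_le hx0 (expWin_norm_le_euclid x)
    obtain ⟨hlo, -⟩ := hR₀ x hR
    have h1 : c / 2 * Real.sqrt (∑ i, ((x i : ℝ)) ^ 2) ^ (-κ) ≤ G x := by
      rw [Real.rpow_neg hE0.le, ← div_eq_mul_inv, div_le_iff₀ (Real.rpow_pos_of_pos hE0 _)]
      exact hlo.le
    have h2 : (Real.sqrt 3 * ‖x‖) ^ (-κ) ≤ Real.sqrt (∑ i, ((x i : ℝ)) ^ 2) ^ (-κ) :=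
      Real.rpow_le_rpow_of_nonpos hE0 (expWin_euclid_le_sqrt_three_mul_norm x) (by linarith)
    calc c / 2 * Real.sqrt 3 ^ (-κ) * ‖x‖ ^ (-κ) = c / 2 * (Real.sqrt 3 * ‖x‖) ^ (-κ) := by
          rw [Real.mul_rpow h3.le hx0.le]; ring
      _ ≤ c / 2 * Real.sqrt (∑ i, ((x i : ℝ)) ^ 2) ^ (-κ) := mul_le_mul_of_nonneg_left h2 (by linarith)
      _ ≤ G x := h1

/-- **Two-sided power bounds for the critical two-point function.**  Scale bounds as above for
`G = criticalTwoPoint 3` (upper for all `x ≠ 0`, lower for `‖x‖ ≥ R₀ ≥ 1`) upgrade to the tree's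
`IsPowerBounded (criticalTwoPoint 3) κ` (both bounds for all `x ≠ 0`): on the finitely many
`0 < ‖x‖ < R₀` use the proved lower bound `c'‖x‖⁻² ≤ G` (`criticalTwoPoint_bounds_holds`,
Duminil-Copin 2019, Thm 4.8) and `‖x‖^{−κ} ≤ 1`. [folklore] -/
theorem expWin_isPowerBounded {κ c₁ C₁ : ℝ} {R₀ : ℕ} (hκ : 0 ≤ κ) (hc₁ : 0 < c₁) (hR₀1 : 1 ≤ R₀)
    (hup : ∀ x : Site 3, x ≠ 0 → criticalTwoPoint 3 x ≤ C₁ * ‖x‖ ^ (-κ))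
    (hlo : ∀ x : Site 3, (R₀ : ℝ) ≤ ‖x‖ → c₁ * ‖x‖ ^ (-κ) ≤ criticalTwoPoint 3 x) :
    IsPowerBounded (criticalTwoPoint 3) κ := by
  obtain ⟨ct, _C, hct, hbd⟩ := criticalTwoPoint_bounds_holds (d := 3) le_rfl
  have hR₀ : (0 : ℝ) < R₀ := Nat.cast_pos.2 hR₀1
  refine ⟨min c₁ (ct * (R₀ : ℝ) ^ (-(((3 : ℕ) : ℝ) - 1))), C₁,
    lt_min hc₁ (mul_pos hct (Real.rpow_pos_of_pos hR₀ _)), fun x hx => ⟨?_, hup x hx⟩⟩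
  have hx0 : 0 < ‖x‖ := norm_pos_iff.2 hx
  have hx1 : (1 : ℝ) ≤ ‖x‖ := by
    -- a nonzero lattice point has integer sup norm `≥ 1`
    -- (cf. `GapForcesFarMerging.Negative.one_le_norm_of_ne_zero`, not imported: foreign route)
    rw [Site.norm_eq_supNorm]
    exact_mod_cast Nat.one_le_iff_ne_zero.2 fun h => hx (Site.supNorm_eq_zero_iff.1 h)
  rcases le_or_gt (R₀ : ℝ) ‖x‖ with hR | hR
  · calc min c₁ (ct * (R₀ : ℝ) ^ (-(((3 : ℕ) : ℝ) - 1))) * ‖x‖ ^ (-κ) ≤ c₁ * ‖x‖ ^ (-κ) :=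
          mul_le_mul_of_nonneg_right (min_le_left _ _) (Real.rpow_nonneg hx0.le _)
      _ ≤ criticalTwoPoint 3 x := hlo x hR
  · have h1 : ‖x‖ ^ (-κ) ≤ 1 := Real.rpow_le_one_of_one_le_of_nonpos hx1 (by linarith)
    have h2 : (R₀ : ℝ) ^ (-(((3 : ℕ) : ℝ) - 1)) ≤ ‖x‖ ^ (-(((3 : ℕ) : ℝ) - 1)) :=
      Real.rpow_le_rpow_of_nonpos hx0 hR.le (by norm_num)
    have h3 := (hbd x hx).1
    have h4 : 0 ≤ ct * (R₀ : ℝ) ^ (-(((3 : ℕ) : ℝ) - 1)) :=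
      mul_nonneg hct.le (Real.rpow_nonneg hR₀.le _)
    calc min c₁ (ct * (R₀ : ℝ) ^ (-(((3 : ℕ) : ℝ) - 1))) * ‖x‖ ^ (-κ)
        ≤ ct * (R₀ : ℝ) ^ (-(((3 : ℕ) : ℝ) - 1)) * ‖x‖ ^ (-κ) :=
          mul_le_mul_of_nonneg_right (min_le_right _ _) (Real.rpow_nonneg hx0.le _)
      _ ≤ ct * (R₀ : ℝ) ^ (-(((3 : ℕ) : ℝ) - 1)) * 1 := mul_le_mul_of_nonneg_left h1 h4
      _ ≤ ct * ‖x‖ ^ (-(((3 : ℕ) : ℝ) - 1)) := by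
          rw [mul_one]; exact mul_le_mul_of_nonneg_left h2 hct.le
      _ ≤ criticalTwoPoint 3 x := h3

/-! ### The stub -/

/-- **Stub S0 `stub_exponentWindow`.**  NonSaturation (item 1342, verbatim) and the isotropic pure
power law of the critical two-point function (item 0634, verbatim) give an exponent
`α := 3 − 2Δ ∈ (1,2)` with `G(x)|x|₂^{3−α} → c > 0` and two-sided sup-norm bounds at scale.
`G ≤ C‖x‖⁻¹` (`criticalTwoPoint_bounds_holds`, via `twoPointLaw_exponent_mem_Icc`) forces `2Δ ≥ 1`;
`2Δ = 1` would give `n G(n e₀) → c > 0`, contradicting NonSaturation, so `α < 2`; the pure power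
law is a two-sided bound, hence the logarithmic exponent `HasIsingExponentEta 3 (2Δ − 1)`
(`HasIsingEtaBounds.hasIsingExponentEta'`), and Duminil-Copin–Panis 2025, Thm 1.5
(`dcp_isingEta_le_half_holds`) gives `2Δ − 1 ≤ 1/2`, so `α ≥ 3/2 > 1`. [folklore] -/
theorem stub_exponentWindow :
    (∀ ε : ℝ, 0 < ε → ∃ᶠ n : ℕ in Filter.atTop, (n : ℝ) * criticalTwoPoint 3 (Pi.single 0 (n : ℤ)) < ε) →
    (∃ Δ c : ℝ, 0 < c ∧ Filter.Tendsto (fun x : Site 3 => criticalTwoPoint 3 x *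
      Real.sqrt (∑ i, ((x i : ℝ)) ^ 2) ^ (2 * Δ)) Filter.cofinite (nhds c)) →
    ∃ (α c c₁ C₁ : ℝ) (R₀ : ℕ), 1 < α ∧ α < 2 ∧ 0 < c ∧ 0 < c₁ ∧
      Filter.Tendsto (fun x : Site 3 => criticalTwoPoint 3 x * Real.sqrt (∑ i, ((x i : ℝ)) ^ 2) ^ (3 - α))
        Filter.cofinite (nhds c) ∧
      (∀ x : Site 3, x ≠ 0 → criticalTwoPoint 3 x ≤ C₁ * ‖x‖ ^ (α - 3)) ∧
      (∀ x : Site 3, (R₀ : ℝ) ≤ ‖x‖ → c₁ * ‖x‖ ^ (α - 3) ≤ criticalTwoPoint 3 x) := by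
  intro hNS hR2
  obtain ⟨Δ, c, hc, hT⟩ := hR2
  -- the tree: `1/2 ≤ Δ ≤ 1`
  obtain ⟨hΔlo, -⟩ := twoPointLaw_exponent_mem_Icc hc hT
  -- NonSaturation excludes `Δ = 1/2`
  have hΔne : Δ ≠ 1 / 2 := by
    intro hΔ
    have hseq : Tendsto (fun n : ℕ => (n : ℝ) * criticalTwoPoint 3 (Pi.single 0 (n : ℤ)))
        atTop (𝓝 c) := by
      refine (hT.comp tendsto_natCast_single_axis_cofinite).congr fun n => ?_
      simp only [Function.comp_apply]
      rw [sqrt_sum_sq_single_axis, hΔ, Int.cast_natCast, Nat.abs_cast,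
        show (2 : ℝ) * (1 / 2) = 1 by norm_num, Real.rpow_one, mul_comm]
    have hev : ∀ᶠ n : ℕ in atTop, c / 2 < (n : ℝ) * criticalTwoPoint 3 (Pi.single 0 (n : ℤ)) :=
      hseq.eventually (lt_mem_nhds (by linarith))
    obtain ⟨n, h1, h2⟩ := ((hNS (c / 2) (by linarith)).and_eventually hev).exists
    linarith
  have hΔgt : 1 / 2 < Δ := lt_of_le_of_ne hΔlo (Ne.symm hΔne)
  -- the scale bounds
  obtain ⟨c₁, C₁, R₀, hc₁, hR₀1, hup, hlo⟩ :=
    expWin_scaleBounds_of_tendsto (G := criticalTwoPoint 3) (κ := 2 * Δ) (by linarith) hc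
      criticalTwoPoint_le_one' hT
  -- Duminil-Copin–Panis: `2Δ - 1 ≤ 1/2`
  have hPB : IsPowerBounded (criticalTwoPoint 3) (2 * Δ) :=
    expWin_isPowerBounded (by linarith) hc₁ hR₀1 hup hlo
  have hEta : HasIsingExponentEta 3 (2 * Δ - 1) := by
    refine HasIsingEtaBounds.hasIsingExponentEta' (d := 3) ?_
    unfold HasIsingEtaBounds
    have h32 : ((3 : ℕ) : ℝ) - 2 + (2 * Δ - 1) = 2 * Δ := by push_cast; ring
    rw [h32]
    exact hPB
  have hΔ34 : Δ ≤ 3 / 4 := by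
    have := dcp_isingEta_le_half_holds (2 * Δ - 1) hEta
    linarith
  -- assemble with `α := 3 - 2Δ`
  refine ⟨3 - 2 * Δ, c, c₁, C₁, R₀, by linarith, by linarith, hc, hc₁, ?_, ?_, ?_⟩
  · have h3 : (3 : ℝ) - (3 - 2 * Δ) = 2 * Δ := by ring
    simp only [h3]
    exact hT
  · intro x hx
    have h3 : (3 : ℝ) - 2 * Δ - 3 = -(2 * Δ) := by ring
    rw [h3]
    exact hup x hx
  · intro x hx
    have h3 : (3 : ℝ) - 2 * Δ - 3 = -(2 * Δ) := by ring
    rw [h3]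
    exact hlo x hx

end Summit.CriticalPhenomena.Ising3DConformalLimit.Cruxes.DirectCorrelationStableTail.DiffusiveBranchIsNonsaturation

end
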